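import Summits.ResolutionOfSingularities.ResolutionOfSingularities.Theorems.EquisingularLiftEquisingularLiftNatTowerBFourPointStepCoreFive
import Summits.ResolutionOfSingularities.ResolutionOfSingularities.Theorems.EquisingularLiftEquisingularLiftNatTowerJointSectionOfConeWitness
import Summits.ResolutionOfSingularities.ResolutionOfSingularities.Theorems.EquisingularLiftEquisingularLiftNatTowerBPointStepsFE
import Summits.ResolutionOfSingularities.ResolutionOfSingularities.Theorems.EquisingularLiftEquisingularLiftNatTowerMemberSection
import Summits.ResolutionOfSingularities.ResolutionOfSingularities.Theorems.EquisingularLiftEquisingularLiftNatResidueHypDefsE9Prime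
import HarnessLib

/-!
# [OURS · L1 W4.5(b) · EL♮(3) · WIDTH TABLE D17 «STAGE-0 TOWER BOOKKEEPING», engine (pt-reg)₅] `Tower.invB₄_ptRegStep₅` — THE `(pt-reg)` STEP OF THE
# RE-TYPED LETTER `TowerPtRegB₅Prime` (E9′, «≤ 2» form) ON `Tower.InvB₄`, and its closure `Tower.towerPtRegB₅Prime_invB₀_FE` on the stage-0 motive `INV₀`

res-L1-w45b-stub-4 g16 (STUB WORKER 4; desk RULING R81 (2) / g27-10 / g27-12 / ★★ R83 / g27-15 of 2026-08-29).  Letter = res-type-027 ✓ `…NatResidueHypDefsE9Prime`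
(`TowerPtRegB₅Prime`: two designated through-members `F₀`, `F₀'`, each REGULAR at the point as a reduced surface, and — if both are distinct members through the
point — crossing transversally along a reduced regular one-dimensional `Z̃ ∋ y` in PAIR-round currency; through-guards `(curvePt G T y ∉ F ∨ F = F₀ ∨ F = F₀')`;
re-typed on this seat's by-type flag STATUS 12:49:04Z, desk R83).  Bricks consumed BY NAME: (n1) ✓ `Tower.exc₄_transport_through` (p720136) and the cores
✓ `Tower.invB₄_pointStep₅` / ✓ `Tower.invB₄_ptRegStep_ofSection` (…NatTowerBFourPointStepCoreFive), (n2b) res-L1-w45b-lead-2 g10 ✓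
`Tower.exists_joint_section_of_coneWitness` (…NatTowerJointSectionOfConeWitness p720395), (n2) res-L1-w45b-stub-2 g20 ✓ `Tower.exists_section_on_memberModel` (…NatTowerMemberSection p720813), res-type-027's ✓ `Tower.invB₄_ptRegStep`, res-L1-w45b-nose-w1 g7's INV₀ shape (✓ `Tower.towerPtRegB₄_invB₀_FE`, …NatTowerBFourPointStepsFEZero).
Crux EL♮(3) = stmt-ResolutionOfSingularities-20148 (parent EL♮ stmt-…-20038; bookkeeping crux stmt-…-15660).  OURS; NOT a statement of any manuscript ([Hironaka2017]
is a candidate under adjudication, nothing of it is asserted); AI-written, weaker than expert review.  DEF-FREE; no `sorry`; standard axioms;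
`--supports stmt-…-20148 --as helper`, counted 0.  EL♮(3) is NOT proved here.

WHAT.
* ★ `Tower.invB₄_ptRegStep₅` — `TowerPtRegB₅Prime`'s hypotheses VERBATIM at a packed `Tower.InvB₄` stage ⊢ `Tower.InvB₄` at the new stage.  Cases: no designated
  member through the point ⇒ ✓ `Tower.invB₄_ptRegStep`; exactly one ⇒ (n2) res-L1-w45b-stub-2 g20's ✓ `Tower.exists_section_on_memberModel` (…NatTowerMemberSection p720813); two distinct ⇒ (n2b) the joint section; then ✓
  `Tower.invB₄_ptRegStep_ofSection` with the guard `Thr F := F = F₀ ∨ F = F₀'`.  STAND-INS `hRuledIso` / `hRuledSt` / `hRuledBirth` as in the ✓ cores and ONE MORE,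
  `hRuledFlat : Ruled … 𝓔 → Flat (V(𝓔) → Spec O)` (the Hensel sections need O-flat models; at `FE` it is the datum itself).
* `Tower.invB₄_ptRegStep₅_FE` — at the engine's datum `FE`, every stand-in discharged.
* ★★ `Tower.towerPtRegB₅Prime_invB₀_FE : ∀ F₉ Z₉ hZ₉ F₁₀ υ', TowerPtRegB₅Prime F₁₀ INV₀` with nose-w1's `INV₀ G γ T E Es Ns K := InvB₄ FE … ∧ IsClosed K ∧ K ⊆ closure (K ∖ E) ∧
  K ≠ univ` — the (T1′) closure the driver (n5) `reachTowerNose₀Prime_of_fact` takes BY NAME (K-side facts = ✓ `Tower.towerPtRegB₄_invB₀_FE`'s, the through-arm has `K' = ∅`).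
[cite: Liu2002, §8.1 and Thm. 8.1.19] [cite: GortzWedhorn2020, Prop. 13.91 (3) and (13.19)] [cite: Grothendieck1967, Thm. 18.5.17] (method; index only).
-/

set_option linter.dupNamespace false -- mandated namespace `Summit.<Summit>.<Problem>` of this single-conjunct summit
set_option linter.overlappingInstances false -- the binders carry `[IsDomain O] [IsDiscreteValuationRing O]`

noncomputable section

open CategoryTheory CategoryTheory.Limits AlgebraicGeometry TopologicalSpace Topology IsLocalRing
open Literature.AlgebraicGeometry.Resolution
open AlgebraicGeometry.Scheme.IdealSheafData
open Summit.ResolutionOfSingularities.ResolutionOfSingularities.Theses.EquisingularLift.Split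
open Summit.ResolutionOfSingularities.ResolutionOfSingularities.Cruxes.EquisingularLift.StrataSplit

namespace Summit.ResolutionOfSingularities.ResolutionOfSingularities.Cruxes.EquisingularLiftNat.Sections


/-! ## The explicit `(pt-reg)` step of the re-typed letter on `Tower.InvB₄` -/

section Steps5

variable (O : Type) [CommRing O] [IsDomain O] [IsDiscreteValuationRing O] [IsAdicComplete (maximalIdeal O) O]
  [IsAlgClosed (ResidueField O)] (k : Type) [Field k] (θ : O →+* k) (hθ : Function.Surjective θ)
  (P : Scheme.{0}) [IsIntegral P] (q : P ⟶ Spec (.of O)) [IsProper q] [SmoothOfRelativeDimension 3 q] (Y : Set P)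
  (hYsp : Y ⊆ q ⁻¹' {closedPoint O}) (hYirr : IsIrreducible Y) (hYcl : IsClosed Y) (hPnoeth : IsLocallyNoetherian P) (hPreg : Scheme.IsRegular P)
  (Ch : ∀ X' : Scheme.{0}, (X' ⟶ P) → Set X' → Prop)
  (hChain : ∀ (X' : Scheme.{0}) (σ : X' ⟶ P) (S : Set X'), Ch X' σ S → Chain P Y X' σ S)
  (hStep : ∀ (X' X'' : Scheme.{0}) (σ' : X' ⟶ P) (S' : Set X') (C : X'.IdealSheafData) (τ : X'' ⟶ X'),
    Ch X' σ' S' → IsBlowup τ C → Scheme.IsRegular C.subscheme → Flat (C.subschemeι ≫ σ' ≫ q) →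
    σ' '' (C.support : Set X') ⊆ {x : P | ¬ IsGenericPoint x Y} →
    (C.support : Set X') ∩ (σ' ≫ q) ⁻¹' {closedPoint O} ⊆ S' →
    Ch X'' (τ ≫ σ') (closure (τ ⁻¹' (S' \ (C.support : Set X')))))
  (Ruled : Tower.RuledDatum P) (F₉ : Scheme.{0}) (Z₉ : Set F₉) (hZ₉ : IsClosed Z₉) (F₁₀ : Scheme.{0}) (υ' : F₁₀ ⟶ F₉)
  (hRuledIso : ∀ (G₀ G₀' : Scheme.{0}) (γ₀ : G₀ ⟶ F₁₀) (γ₀' : G₀' ⟶ F₁₀) (E₀ : Set G₀) (E₀' : Set G₀') (X₀ X₀'' : Scheme.{0})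
      (σ₀ : X₀ ⟶ P) (j₀ : G₀ ⟶ X₀) (j₀' : G₀' ⟶ X₀'') (𝓔₀ : X₀.IdealSheafData) (τ₀ : X₀'' ⟶ X₀),
    (∃ e : (𝓔₀.comap τ₀).subscheme ≅ 𝓔₀.subscheme, e.hom ≫ 𝓔₀.subschemeι = (𝓔₀.comap τ₀).subschemeι ≫ τ₀) →
    Ruled F₉ Z₉ hZ₉ F₁₀ υ' G₀ γ₀ E₀ X₀ σ₀ j₀ 𝓔₀ → Ruled F₉ Z₉ hZ₉ F₁₀ υ' G₀' γ₀' E₀' X₀'' (τ₀ ≫ σ₀) j₀' (𝓔₀.comap τ₀))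
  (hRuledSt : ∀ (G₀ G₀' : Scheme.{0}) (γ₀ : G₀ ⟶ F₁₀) (γ₀' : G₀' ⟶ F₁₀) (E₀ : Set G₀) (E₀' : Set G₀') (X₀ X₀'' : Scheme.{0})
      (σ₀ : X₀ ⟶ P) (j₀ : G₀ ⟶ X₀) (j₀' : G₀' ⟶ X₀'') (𝓔₀ C₀ : X₀.IdealSheafData) (τ₀ : X₀'' ⟶ X₀),
    IsBlowup τ₀ C₀ → IsLocallyNoetherian X₀ → IsLocallyNoetherian X₀'' →
    Ruled F₉ Z₉ hZ₉ F₁₀ υ' G₀ γ₀ E₀ X₀ σ₀ j₀ 𝓔₀ →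
    Ruled F₉ Z₉ hZ₉ F₁₀ υ' G₀' γ₀' E₀' X₀'' (τ₀ ≫ σ₀) j₀' (strictTransformIdeal τ₀ C₀ 𝓔₀))
  (hRuledBirth : ∀ (G₀ G₀' : Scheme.{0}) (γ₀' : G₀' ⟶ F₁₀) (E₀' : Set G₀') (X₀ X₀'' : Scheme.{0}) (σ₀ : X₀ ⟶ P) (j₀' : G₀' ⟶ X₀'')
      (s₀ : Spec (.of O) ⟶ X₀) (τ₀ : X₀'' ⟶ X₀),
    IsBlowup τ₀ s₀.ker → Flat ((s₀.ker.comap τ₀).subschemeι ≫ (τ₀ ≫ σ₀) ≫ q) →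
    Ruled F₉ Z₉ hZ₉ F₁₀ υ' G₀' γ₀' E₀' X₀'' (τ₀ ≫ σ₀) j₀' (s₀.ker.comap τ₀))
  -- D17: the ruled datum of a model makes it O-FLAT (at `FE` it IS flatness) — the Hensel sections on the through-members' models need it
  (hRuledFlat : ∀ (G₀ : Scheme.{0}) (γ₀ : G₀ ⟶ F₁₀) (E₀ : Set G₀) (X₀ : Scheme.{0}) (σ₀ : X₀ ⟶ P) (j₀ : G₀ ⟶ X₀) (𝓔₀ : X₀.IdealSheafData),
    Ruled F₉ Z₉ hZ₉ F₁₀ υ' G₀ γ₀ E₀ X₀ σ₀ j₀ 𝓔₀ → Flat (𝓔₀.subschemeι ≫ σ₀ ≫ q))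

include hθ hYsp hYirr hYcl hPnoeth hPreg hChain hStep hRuledIso hRuledSt hRuledBirth hRuledFlat

/-- ★ **`Tower.invB₄_ptRegStep₅` — THE `(pt-reg)` STEP OF THE RE-TYPED LETTER `TowerPtRegB₅Prime` ON `Tower.InvB₄`**: the letter's hypotheses VERBATIM (two
designated members `F₀`, `F₀'`, regular at the point when they are members through it; transversal crossing along a reduced regular one-dimensional `Z̃ ∋ y`
when both are; the menus with through-guards `(curvePt G T y ∉ F ∨ F = F₀ ∨ F = F₀')`) at a packed `Tower.InvB₄` stage ⊢ `Tower.InvB₄` at the new stage.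
No designated member through the point ⇒ ✓ `Tower.invB₄_ptRegStep`; one ⇒ (n2) ✓ `Tower.exists_section_on_memberModel` (res-L1-w45b-stub-2); two ⇒ (n2b) ✓
`Tower.exists_joint_section_of_coneWitness` (res-L1-w45b-lead-2); then ✓ `Tower.invB₄_ptRegStep_ofSection`.
[cite: Liu2002, §8.1 and Thm. 8.1.19] [cite: GortzWedhorn2020, Prop. 13.91 (3) and (13.19)] [cite: Grothendieck1967, Thm. 18.5.17]
[OURS · L1 W4.5b · D17 engine (pt-reg)₅] toward the rung `nose_tower_rung_three`; NOT a statement of the manuscript. -/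
theorem Tower.invB₄_ptRegStep₅
    (G G' : Scheme.{0}) (γ : G ⟶ F₁₀) (T E : Set G) (Es Ns : List (Set G)) (K F₀ F₀' : Set G)
    (y : redSub G (closure T) isClosed_closure) (υ₂ : G' ⟶ G) (hyc : IsClosed ({curvePt G T y} : Set G))
    (K' E' : Set G') (Es' Ns' : List (Set G'))
    (hinv : Tower.InvB₄ O k θ P q Y Ch Ruled F₉ Z₉ hZ₉ F₁₀ υ' G γ T E Es Ns K)
    (hTreg : ¬ IsRegularLocalRing ((redSub G (closure T) isClosed_closure).presheaf.stalk y))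
    (hGreg : IsRegularLocalRing (G.presheaf.stalk (curvePt G T y)))
    (hυ₂ : IsBlowup υ₂ (vanishingIdeal (⟨{curvePt G T y}, hyc⟩ : Closeds G)))
    (hF₀reg : F₀ ∈ E :: Es → curvePt G T y ∈ F₀ → ∀ (hF₀ : IsClosed F₀) (e : ↥(redSub G F₀ hF₀)),
      (redSubι G F₀ hF₀ e : G) = curvePt G T y → IsRegularLocalRing ((redSub G F₀ hF₀).presheaf.stalk e))
    (hF₀'reg : F₀' ∈ E :: Es → curvePt G T y ∈ F₀' → ∀ (hF₀' : IsClosed F₀') (e : ↥(redSub G F₀' hF₀')),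
      (redSubι G F₀' hF₀' e : G) = curvePt G T y → IsRegularLocalRing ((redSub G F₀' hF₀').presheaf.stalk e))
    (hcross : F₀ ∈ E :: Es → F₀' ∈ E :: Es → F₀ ≠ F₀' → curvePt G T y ∈ F₀ → curvePt G T y ∈ F₀' → ∀ (hF₀ : IsClosed F₀),
      ∃ (Z : Set G) (hZ : IsClosed Z), ConeWitness G F₀ hF₀ F₀' Z hZ ∧ curvePt G T y ∈ Z ∧
        (∀ x : redSub G Z hZ, IsRegularLocalRing ((redSub G Z hZ).presheaf.stalk x)) ∧
        (∀ z : ↥(redSub G Z hZ), IsClosed ({z} : Set ↥(redSub G Z hZ)) → ringKrullDim ((redSub G Z hZ).presheaf.stalk z) = ((1 : ℕ) : WithBot ℕ∞)))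
    (hK' : K' = ∅ ∨ (curvePt G T y ∉ closure K ∧ K' = closure (υ₂ ⁻¹' (K \ {curvePt G T y}))))
    (hE' : E' = υ₂ ⁻¹' {curvePt G T y} ∨ (curvePt G T y ∉ E ∧ E' = closure (υ₂ ⁻¹' (E \ {curvePt G T y}))) ∨
      (∃ F ∈ E :: Es, (curvePt G T y ∉ F ∨ F = F₀ ∨ F = F₀') ∧ E' = closure (υ₂ ⁻¹' (F \ {curvePt G T y})) ∧ K' = ∅))
    (hEs' : ∀ F' ∈ Es', (∃ F ∈ E :: Es, (curvePt G T y ∉ F ∨ F = F₀ ∨ F = F₀') ∧ F' = closure (υ₂ ⁻¹' (F \ {curvePt G T y}))) ∨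
      F' = υ₂ ⁻¹' {curvePt G T y})
    (hNs' : ∀ F' ∈ Ns', (∃ F ∈ (E :: Es) ++ Ns, F' = closure (υ₂ ⁻¹' (F \ {curvePt G T y}))) ∨ F' = υ₂ ⁻¹' {curvePt G T y}) :
    Tower.InvB₄ O k θ P q Y Ch Ruled F₉ Z₉ hZ₉ F₁₀ υ' G' (υ₂ ≫ γ) (closure (υ₂ ⁻¹' (T \ {curvePt G T y}))) E' Es' Ns' K' := by
  classical
  ----------------------------------------------------------------
  -- (0) NO designated member through the point: every `F = F₀ ∨ F = F₀'` instance is an away instance — this is 027's `(pt-reg)` step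
  ----------------------------------------------------------------
  by_cases hnone : ∀ F ∈ E :: Es, (F = F₀ ∨ F = F₀') → curvePt G T y ∉ F
  · have conv : ∀ F ∈ E :: Es, (curvePt G T y ∉ F ∨ F = F₀ ∨ F = F₀') → curvePt G T y ∉ F := by
      rintro F hF (h | h)
      · exact h
      · exact hnone F hF h
    refine Tower.invB₄_ptRegStep O k θ hθ P q Y hYsp hYirr hYcl hPnoeth hPreg Ch hChain hStep Ruled F₉ Z₉ hZ₉ F₁₀ υ' hRuledIso hRuledBirth
      G G' γ T E Es Ns K y υ₂ hyc K' E' Es' Ns' hinv hTreg hGreg hυ₂ hK' ?_ ?_ hNs'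
    · rcases hE' with h | h | ⟨F, hF, hor, hE, hK⟩
      · exact Or.inl h
      · exact Or.inr (Or.inl h)
      · exact Or.inr (Or.inr ⟨F, hF, conv F hF hor, hE, hK⟩)
    · intro F' hF'
      rcases hEs' F' hF' with ⟨F, hF, hor, hE⟩ | h
      · exact Or.inl ⟨F, hF, conv F hF hor, hE⟩
      · exact Or.inr h
  ----------------------------------------------------------------
  -- some designated member passes through the point: unpack the stage, open the members' data
  ----------------------------------------------------------------
  obtain ⟨hυ', hZ₉inf, hGint, hTcl, hTirr, hEcl, hTE, hEsB, hNsB, X, σ, S, jG, tG, hCh, hXint, hXnoeth, hXreg, hdom, hsq, hTS, hExc, hExcF⟩ :=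
    hinv
  haveI := hGint
  haveI := hXint
  haveI := hXnoeth
  haveI := hdom
  obtain ⟨-, -, hσ⟩ := chain_isRegular P Y X σ S (hChain _ _ _ hCh) hPnoeth hPreg
  haveI := hσ
  haveI hproper : IsProper (σ ≫ q) := inferInstance
  haveI : IsSeparated (σ ≫ q) := inferInstance
  -- opening a member: closed, `T ⊄ M`, a model with its clauses and the ruled datum, `≠ ⊥`
  have hopen : ∀ M ∈ E :: Es, ∃ (hM : IsClosed M) (𝓜 : X.IdealSheafData), ¬ T ⊆ M ∧
      𝓜.comap jG = vanishingIdeal (⟨M, hM⟩ : Closeds G) ∧ (∀ z : X, (stalkIdeal 𝓜 z).IsPrincipal) ∧ Scheme.IsRegular 𝓜.subscheme ∧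
      σ '' (𝓜.support : Set X) ⊆ {p : P | ¬ IsGenericPoint p Y} ∧ Ruled F₉ Z₉ hZ₉ F₁₀ υ' G γ M X σ jG 𝓜 ∧ 𝓜 ≠ ⊥ := by
    intro M hM
    obtain ⟨hMcl, hTM, 𝓜, h1, h2, h3, h4, h5⟩ : ∃ hM : IsClosed M, ¬ T ⊆ M ∧ ∃ 𝓜 : X.IdealSheafData,
        𝓜.comap jG = vanishingIdeal (⟨M, hM⟩ : Closeds G) ∧ (∀ z : X, (stalkIdeal 𝓜 z).IsPrincipal) ∧ Scheme.IsRegular 𝓜.subscheme ∧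
        σ '' (𝓜.support : Set X) ⊆ {p : P | ¬ IsGenericPoint p Y} ∧ Ruled F₉ Z₉ hZ₉ F₁₀ υ' G γ M X σ jG 𝓜 := by
      rcases List.mem_cons.mp hM with rfl | hM
      · obtain ⟨𝓜, h1, h2, h3, h4, h5, -⟩ := hExc hEcl
        exact ⟨hEcl, hTE, 𝓜, h1, h2, h3, h4, h5⟩
      · obtain ⟨𝓜, h1, h2, h3, h4, h5, -⟩ := hExcF M hM (hEsB M hM).1
        exact ⟨(hEsB M hM).1, (hEsB M hM).2, 𝓜, h1, h2, h3, h4, h5⟩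
    refine ⟨hMcl, 𝓜, hTM, h1, h2, h3, h4, h5, fun h => hTM ?_⟩
    have h6 : (vanishingIdeal (⟨M, hMcl⟩ : Closeds G) : G.IdealSheafData) = ⊥ := by
      rw [← h1, h, Scheme.IdealSheafData.comap_bot]
    have h7 : ((vanishingIdeal (⟨M, hMcl⟩ : Closeds G)).support : Set G) = Set.univ := by
      rw [h6, Scheme.IdealSheafData.support_bot]; rfl
    rw [Scheme.IdealSheafData.coe_support_vanishingIdeal] at h7
    intro t _
    have ht : t ∈ (Set.univ : Set G) := trivial
    rwa [← h7] at ht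
  -- the conclusion from a section lying on the models of all designated members through the point
  have finish : ∀ (s : Spec (.of O) ⟶ X), s ≫ σ ≫ q = 𝟙 _ → s (closedPoint O) = jG (curvePt G T y) →
      (∀ F ∈ E :: Es, (F = F₀ ∨ F = F₀') → curvePt G T y ∈ F → ∃ (hF : IsClosed F) (𝓕 : X.IdealSheafData),
        𝓕.comap jG = vanishingIdeal (⟨F, hF⟩ : Closeds G) ∧ (∀ z : X, (stalkIdeal 𝓕 z).IsPrincipal) ∧ Scheme.IsRegular 𝓕.subscheme ∧
        σ '' (𝓕.support : Set X) ⊆ {p : P | ¬ IsGenericPoint p Y} ∧ Ruled F₉ Z₉ hZ₉ F₁₀ υ' G γ F X σ jG 𝓕 ∧ 𝓕 ≤ s.ker ∧ 𝓕 ≠ ⊥) →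
      Tower.InvB₄ O k θ P q Y Ch Ruled F₉ Z₉ hZ₉ F₁₀ υ' G' (υ₂ ≫ γ) (closure (υ₂ ⁻¹' (T \ {curvePt G T y}))) E' Es' Ns' K' :=
    fun s hs hss₀ hthr =>
      Tower.invB₄_ptRegStep_ofSection O k θ hθ P q Y hYsp hYirr hYcl hPnoeth hPreg Ch hChain hStep Ruled Z₉ hZ₉ υ' hRuledIso hRuledSt hRuledBirth
        (fun {G₀} (F : Set G₀) => ∃ (h : G₀ = G), h ▸ F = F₀ ∨ h ▸ F = F₀') G G' γ T E Es Ns K y υ₂ hyc K' E' Es' Ns' hυ' hZ₉inf hTcl hTirr hEcl hTE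
        hEsB hNsB X σ S jG tG hCh hXreg hdom hsq hTS hExc hExcF hTreg hGreg hυ₂ s hs hss₀
        (fun F hF hThr hyF => by
          obtain ⟨h, hThr⟩ := hThr
          cases h
          exact hthr F hF hThr hyF)
        hK'
        (by
          rcases hE' with h | h | ⟨F, hF, hor, hE, hK⟩
          · exact Or.inl h
          · exact Or.inr (Or.inl h)
          · refine Or.inr (Or.inr ⟨F, hF, ?_, hE, hK⟩)
            rcases hor with h | h
            · exact Or.inl h
            · exact Or.inr ⟨rfl, h⟩)
        (by
          intro F' hF'
          rcases hEs' F' hF' with ⟨F, hF, hor, hE⟩ | h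
          · refine Or.inl ⟨F, hF, ?_, hE⟩
            rcases hor with h | h
            · exact Or.inl h
            · exact Or.inr ⟨rfl, h⟩
          · exact Or.inr h)
        hNs'
  ----------------------------------------------------------------
  -- (1) ONE designated member through the point (the other absent, away, or equal): the one-member section
  ----------------------------------------------------------------
  have one : ∀ M ∈ E :: Es, curvePt G T y ∈ M →
      (∀ (hM : IsClosed M) (e : ↥(redSub G M hM)), (redSubι G M hM e : G) = curvePt G T y → IsRegularLocalRing ((redSub G M hM).presheaf.stalk e)) →
      (∀ F ∈ E :: Es, (F = F₀ ∨ F = F₀') → curvePt G T y ∈ F → F = M) →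
      Tower.InvB₄ O k θ P q Y Ch Ruled F₉ Z₉ hZ₉ F₁₀ υ' G' (υ₂ ≫ γ) (closure (υ₂ ⁻¹' (T \ {curvePt G T y}))) E' Es' Ns' K' := by
    intro M hM hyM hMreg huniq
    obtain ⟨hMcl, 𝓜, -, h1, h2, h3, h4, h5, h0⟩ := hopen M hM
    obtain ⟨s, hs, hss₀, hle⟩ := Tower.exists_section_on_memberModel O k θ hθ σ q jG tG hsq 𝓜 h3 (hRuledFlat G γ M X σ jG 𝓜 h5) hMcl h1
      (curvePt G T y) hyM hyc (hMreg hMcl)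
    refine finish s hs hss₀ fun F hF hThr hyF => ?_
    have hFM : F = M := huniq F hF hThr hyF
    subst hFM
    exact ⟨hMcl, 𝓜, h1, h2, h3, h4, h5, hle, h0⟩
  by_cases h₀ : F₀ ∈ E :: Es ∧ curvePt G T y ∈ F₀
  swap
  · -- only `F₀'` passes
    have h₀' : F₀' ∈ E :: Es ∧ curvePt G T y ∈ F₀' := by
      by_contra h
      apply hnone
      rintro F hF (rfl | rfl) hyF
      · exact h₀ ⟨hF, hyF⟩
      · exact h ⟨hF, hyF⟩
    refine one F₀' h₀'.1 h₀'.2 (hF₀'reg h₀'.1 h₀'.2) ?_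
    rintro F hF (rfl | rfl) hyF
    · exact absurd ⟨hF, hyF⟩ h₀
    · rfl
  by_cases h₀' : F₀' ∈ E :: Es ∧ curvePt G T y ∈ F₀' ∧ F₀ ≠ F₀'
  swap
  · -- only `F₀` passes (or `F₀' = F₀`)
    refine one F₀ h₀.1 h₀.2 (hF₀reg h₀.1 h₀.2) ?_
    rintro F hF (rfl | rfl) hyF
    · rfl
    · by_contra hne
      exact h₀' ⟨hF, hyF, fun h => hne h.symm⟩
  ----------------------------------------------------------------
  -- (2) TWO distinct designated members through the point: (n2b) the joint section on their models
  ----------------------------------------------------------------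
  obtain ⟨hF₀mem, hyF₀⟩ := h₀
  obtain ⟨hF₀'mem, hyF₀', hne⟩ := h₀'
  obtain ⟨hF₀cl, 𝓕₀, hTF₀, he1, he2, he3, he4, he5, he0⟩ := hopen F₀ hF₀mem
  obtain ⟨hF₀'cl, 𝓕₀', hTF₀', hw1, hw2, hw3, hw4, hw5, hw0⟩ := hopen F₀' hF₀'mem
  obtain ⟨Z, hZ, hpair, hyZ, hZreg, hZdim⟩ := hcross hF₀mem hF₀'mem hne hyF₀ hyF₀' hF₀cl
  obtain ⟨s, hs, hss₀, -, -, hle, hle', -, -⟩ :=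
    Tower.exists_joint_section_of_coneWitness O k θ hθ P q Y hYirr hYcl hPnoeth hPreg Ch hChain Z₉ hZ₉ υ' G γ T F₀ hF₀cl Z hZ F₀' hF₀'cl hTF₀ hpair
      hZreg hZdim X σ S jG tG hCh hXint hXnoeth hXreg hdom hsq hTS 𝓕₀ 𝓕₀' he1 he2 he3 he4 (hRuledFlat G γ F₀ X σ jG 𝓕₀ he5) hw1 hw2 hw3 hw4
      (hRuledFlat G γ F₀' X σ jG 𝓕₀' hw5) hTF₀' (curvePt G T y) hyZ hyc
  refine finish s hs hss₀ fun F hF hThr hyF => ?_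
  rcases hThr with rfl | rfl
  · exact ⟨hF₀cl, 𝓕₀, he1, he2, he3, he4, he5, hle, he0⟩
  · exact ⟨hF₀'cl, 𝓕₀', hw1, hw2, hw3, hw4, hw5, hle', hw0⟩

omit hRuledIso hRuledSt hRuledBirth hRuledFlat in
/-- ★ **`Tower.invB₄_ptRegStep₅_FE` — the same at the engine's datum `FE` («`V(𝓔)` is O-flat»)**, every stand-in discharged: `hRuledIso := Tower.feIsoC`,
`hRuledSt := flat_strictTransform_subschemeι_comp_stage`, `hRuledBirth := fun … h => h`, `hRuledFlat := fun … h => h`.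
[OURS · L1 W4.5b · D17 engine (pt-reg)₅ at FE]; NOT a statement of the manuscript. -/
theorem Tower.invB₄_ptRegStep₅_FE
    (G G' : Scheme.{0}) (γ : G ⟶ F₁₀) (T E : Set G) (Es Ns : List (Set G)) (K F₀ F₀' : Set G)
    (y : redSub G (closure T) isClosed_closure) (υ₂ : G' ⟶ G) (hyc : IsClosed ({curvePt G T y} : Set G))
    (K' E' : Set G') (Es' Ns' : List (Set G'))
    (hinv : Tower.InvB₄ O k θ P q Y Ch (fun _ _ _ _ _ _ _ _ _ σ _ 𝓔 => Flat (𝓔.subschemeι ≫ σ ≫ q)) F₉ Z₉ hZ₉ F₁₀ υ' G γ T E Es Ns K)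
    (hTreg : ¬ IsRegularLocalRing ((redSub G (closure T) isClosed_closure).presheaf.stalk y))
    (hGreg : IsRegularLocalRing (G.presheaf.stalk (curvePt G T y)))
    (hυ₂ : IsBlowup υ₂ (vanishingIdeal (⟨{curvePt G T y}, hyc⟩ : Closeds G)))
    (hF₀reg : F₀ ∈ E :: Es → curvePt G T y ∈ F₀ → ∀ (hF₀ : IsClosed F₀) (e : ↥(redSub G F₀ hF₀)),
      (redSubι G F₀ hF₀ e : G) = curvePt G T y → IsRegularLocalRing ((redSub G F₀ hF₀).presheaf.stalk e))
    (hF₀'reg : F₀' ∈ E :: Es → curvePt G T y ∈ F₀' → ∀ (hF₀' : IsClosed F₀') (e : ↥(redSub G F₀' hF₀')),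
      (redSubι G F₀' hF₀' e : G) = curvePt G T y → IsRegularLocalRing ((redSub G F₀' hF₀').presheaf.stalk e))
    (hcross : F₀ ∈ E :: Es → F₀' ∈ E :: Es → F₀ ≠ F₀' → curvePt G T y ∈ F₀ → curvePt G T y ∈ F₀' → ∀ (hF₀ : IsClosed F₀),
      ∃ (Z : Set G) (hZ : IsClosed Z), ConeWitness G F₀ hF₀ F₀' Z hZ ∧ curvePt G T y ∈ Z ∧
        (∀ x : redSub G Z hZ, IsRegularLocalRing ((redSub G Z hZ).presheaf.stalk x)) ∧
        (∀ z : ↥(redSub G Z hZ), IsClosed ({z} : Set ↥(redSub G Z hZ)) → ringKrullDim ((redSub G Z hZ).presheaf.stalk z) = ((1 : ℕ) : WithBot ℕ∞)))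
    (hK' : K' = ∅ ∨ (curvePt G T y ∉ closure K ∧ K' = closure (υ₂ ⁻¹' (K \ {curvePt G T y}))))
    (hE' : E' = υ₂ ⁻¹' {curvePt G T y} ∨ (curvePt G T y ∉ E ∧ E' = closure (υ₂ ⁻¹' (E \ {curvePt G T y}))) ∨
      (∃ F ∈ E :: Es, (curvePt G T y ∉ F ∨ F = F₀ ∨ F = F₀') ∧ E' = closure (υ₂ ⁻¹' (F \ {curvePt G T y})) ∧ K' = ∅))
    (hEs' : ∀ F' ∈ Es', (∃ F ∈ E :: Es, (curvePt G T y ∉ F ∨ F = F₀ ∨ F = F₀') ∧ F' = closure (υ₂ ⁻¹' (F \ {curvePt G T y}))) ∨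
      F' = υ₂ ⁻¹' {curvePt G T y})
    (hNs' : ∀ F' ∈ Ns', (∃ F ∈ (E :: Es) ++ Ns, F' = closure (υ₂ ⁻¹' (F \ {curvePt G T y}))) ∨ F' = υ₂ ⁻¹' {curvePt G T y}) :
    Tower.InvB₄ O k θ P q Y Ch (fun _ _ _ _ _ _ _ _ _ σ _ 𝓔 => Flat (𝓔.subschemeι ≫ σ ≫ q)) F₉ Z₉ hZ₉ F₁₀ υ' G' (υ₂ ≫ γ)
      (closure (υ₂ ⁻¹' (T \ {curvePt G T y}))) E' Es' Ns' K' := by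
  refine Tower.invB₄_ptRegStep₅ O k θ hθ P q Y hYsp hYirr hYcl hPnoeth hPreg Ch hChain hStep _ F₉ Z₉ hZ₉ F₁₀ υ'
    (Tower.feIsoC O P q Z₉ hZ₉ υ') ?_ (fun _ _ _ _ _ _ _ _ _ _ _ h => h) (fun _ _ _ _ _ _ _ h => h) G G' γ T E Es Ns K F₀ F₀' y υ₂ hyc K' E' Es' Ns'
    hinv hTreg hGreg hυ₂ hF₀reg hF₀'reg hcross hK' hE' hEs' hNs'
  intro G₀ G₀' γ₀ γ₀' E₀ E₀' X₀ X₀'' σ₀ j₀ j₀' 𝓔₀ C₀ τ₀ hτ₀ hX₀ hX₀'' hflat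
  haveI := hX₀
  haveI := hX₀''
  exact flat_strictTransform_subschemeι_comp_stage O σ₀ q τ₀ C₀ hτ₀ 𝓔₀ hflat

omit hRuledIso hRuledSt hRuledBirth hRuledFlat in
/-- ★★ **`(pt-reg)′` — THE RE-TYPED LETTER `TowerPtRegB₅Prime F₁₀ INV₀` ON THE STAGE-0 MOTIVE AT `FE`** (res-L1-w45b-nose-w1's `INV₀ := InvB₄ FE … ∧ IsClosed K ∧
K ⊆ closure (K ∖ E) ∧ K ≠ univ`, ✓ `Tower.towerPtRegB₄_invB₀_FE`'s motive token for token): a fold over `Tower.invB₄_ptRegStep₅_FE` plus the K-side facts (the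
THROUGH-arm carries `K' = ∅`).  The (T1′) closure the driver (n5) `reachTowerNose₀Prime_of_fact` consumes BY NAME.
[OURS · L1 W4.5b · D17 engine (T1′) closure; counted 0; EL♮(3) NOT proved]; NOT a statement of the manuscript. -/
theorem Tower.towerPtRegB₅Prime_invB₀_FE :
    ∀ (F₉ : Scheme.{0}) (Z₉ : Set F₉) (hZ₉ : IsClosed Z₉) (F₁₀ : Scheme.{0}) (υ' : F₁₀ ⟶ F₉),
      TowerPtRegB₅Prime F₁₀ (fun G γ T E Es Ns K =>
        Tower.InvB₄ O k θ P q Y Ch (fun _ _ _ _ _ _ _ _ _ σ _ 𝓔 => Flat (𝓔.subschemeι ≫ σ ≫ q)) F₉ Z₉ hZ₉ F₁₀ υ' G γ T E Es Ns K ∧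
          IsClosed K ∧ K ⊆ closure (K \ E) ∧ K ≠ Set.univ) := by
  -- adapted from res-L1-w45b-nose-w1's `Tower.towerPtRegB₄_invB₀_FE` (…NatTowerBFourPointStepsFEZero): the step is `invB₄_ptRegStep₅_FE`
  intro F₉ Z₉ hZ₉ F₁₀ υ' G G' γ T E Es Ns K F₀ F₀' y υ₂ hy K' E' Es' Ns' hinv hTreg hGreg hυ₂ hF₀reg hF₀'reg hcross hK' hE' hEs' hNs'
  obtain ⟨hinv, hKcl, hKE, hKne⟩ := hinv
  have hI₂ := Tower.invB₄_ptRegStep₅_FE O k θ hθ P q Y hYsp hYirr hYcl hPnoeth hPreg Ch hChain hStep F₉ Z₉ hZ₉ F₁₀ υ' G G' γ T E Es Ns K F₀ F₀' y υ₂ hy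
    K' E' Es' Ns' hinv hTreg hGreg hυ₂ hF₀reg hF₀'reg hcross hK' hE' hEs' hNs'
  refine (fun h3 => ⟨hI₂, h3⟩) ?_
  obtain ⟨-, -, hGint, -, hTirr, hEcl, hTE, hEsB, -⟩ := hinv
  obtain ⟨-, -, hG'int, -⟩ := hI₂
  haveI := hGint
  haveI := hG'int
  have hTy : ¬ T ⊆ {curvePt G T y} := not_subset_singleton_of_not_isRegularLocalRing_stalk y hTreg hy
  have hDsupp : ((vanishingIdeal (⟨{curvePt G T y}, hy⟩ : Closeds G) : G.IdealSheafData).support : Set G) = {curvePt G T y} :=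
    Scheme.IdealSheafData.coe_support_vanishingIdeal _
  rcases hK' with rfl | ⟨hyK, rfl⟩
  · exact ⟨isClosed_empty, by simp, Set.empty_ne_univ⟩
  · refine ⟨isClosed_closure, ?_, closure_preimage_ne_univ υ₂ _ hυ₂ K {curvePt G T y} hKcl hKne hy
      (fun h => hTy (h ▸ Set.subset_univ _)) hDsupp.le _ (Set.preimage_mono fun z hz => hz.1)⟩
    rcases hE' with rfl | ⟨-, rfl⟩ | ⟨F, -, -, -, hK0⟩
    · exact closure_preimage_diff_subset_closure_diff_preimage υ₂ K {curvePt G T y}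
    · have h := closure_preimage_diff_subset_of_isBlowup υ₂ (vanishingIdeal (⟨{curvePt G T y}, hy⟩ : Closeds G)) hυ₂ K E hEcl hKE
      rw [hDsupp] at h
      exact h
    · rw [hK0]; exact Set.empty_subset _

end Steps5

end Summit.ResolutionOfSingularities.ResolutionOfSingularities.Cruxes.EquisingularLiftNat.Sections

end
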